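import Literature.Combinatorics.Sahi2008.LebesgueCube
import Summits.CriticalPhenomena.PercolationContinuityZ3.Theorems.PercNearOneGluingNoHeavyLowerTailSahiUniformGrid
import Summits.CriticalPhenomena.PercolationContinuityZ3.Theorems.SahiGFConjecture
import Summits.CriticalPhenomena.PercolationContinuityZ3.Theorems.PercNearOneGluingNoHeavyLowerTailSahiThreeDimFKG

/-!
# Sahi's Conjecture 5 ⟺ Lieb–Sahi's continuous case (Lebesgue measure on the unit hypercubes `Q_d`),
# order by order — the continuum layer of the width stratification

Companion of `SahiConjecture.lean` / `SahiGFConjecture.lean` (cell `prim-sahi`, typer, generation 6;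
`--supports stmt-CriticalPhenomena-4575`).

Lieb–Sahi [LiebSahi2021, §1]: "the FKG inequality also has important continuous versions, which can be proved by
discrete approximation … We consider the continuous case of the Lebesgue measure on the unit hypercube
`Q_k = [0,1]^k` in `ℝ^k`" — and prove `E_n ≥ 0` there for `k = 2` (Thm. 3.7, tree `liebSahi_thm37`) and for
rectangle indicators (Thm. 3.5, tree `liebSahi_thm35_volume`).  By the tree's placement rule the continuous case
ITSELF — `E_n(f_1,…,f_n) ≥ 0` for positive monotone (decreasing) functions on `Q_d` with Lebesgue measure — is
stated HERE as the `@[conjecture]` obligation `LiebSahiContinuum d n` (open for `d ≥ 3`, `n ≥ 3`), and this file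
PROVES that it is not merely "evidence" for Sahi's conjecture but EQUIVALENT to it:

* `liebSahiContinuum_iff_uniformGrid d n` — Lebesgue measure on `Q_d` ⟺ the uniform weight on every discrete box
  `[M]^d` (Lieb–Sahi's discretisation Lemma 2.3/3.8 in dimension `d`, tree
  `LebesgueCube.mSahiPositive_volume_iff_uniformGrid`, plus the reflection `x ↦ 1 − x`);
* `liebSahiContinuum_iff_prodGrid`, `liebSahiContinuum_iff_fkgGrid` — ⟺ every product / every FKG probability
  weight on every grid `[K+1]^d` (the width stratification `U(d,n) ⟺ P(d,n) ⟺ W(d,n)` of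
  `…SahiWidthStratification.lean` / `…SahiUniformGrid.lean`, seat P1), hence (`sahiPositive_of_liebSahiContinuum_
  of_latticeEmbedding`) `E_n ≥ 0` for every FKG weight on every finite distributive lattice of J-width `≤ d`;
* **`sahiConjecture_iff_forall_liebSahiContinuum n : SahiConjecture n ↔ ∀ d, LiebSahiContinuum d n`** and
  **`forall_sahiConjecture_iff_forall_liebSahiContinuum : (∀ n, SahiConjecture n) ↔ ∀ d n, LiebSahiContinuum d n`**
  — Sahi's Conjecture 5 [Sahi2008] = Lieb–Sahi's Conjecture 1.1 on all finite FKG posets is EQUIVALENT to its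
  continuous case for Lebesgue measure on all unit hypercubes; likewise `sahiGFConjecture_iff_…` (Sahi's
  Conjecture 4 / Lieb–Sahi's Conjecture 1.2) and `kahnConjecture_iff_…` (Kahn's Conjecture 5 ⟺ `Q_d` at order 3);
* the obligation is antitone in `n` (`LiebSahiContinuum.anti`, the hierarchy) and in `d`
  (`LiebSahiContinuum.of_le_dim`: `Q_d ↪ Q_{d'}` by zero padding of boxes), and the layers `d ≤ 2` are THEOREMS
  (`liebSahiContinuum_of_le_two`: chains, and Lieb–Sahi's Theorem 3.7); `d = 3` is the first open layer.

So the hypercube DIMENSION `d` of the analysts' formulation is exactly the lattice WIDTH `d` of the combinatorial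
one.  Heads are `↔` / `→` between obligations; nothing here asserts `LiebSahiContinuum d n` for `d ≥ 3`,
`SahiConjecture n`, `SahiGFConjecture` or `KahnConjecture` (all `[status: open]`).
-/

noncomputable section

namespace Summit.CriticalPhenomena.PercolationContinuityZ3.Theorems

open MeasureTheory Finset Literature.Combinatorics.Sahi2008
open scoped unitInterval BigOperators

/-- **Lieb–Sahi's continuous case of Sahi's conjecture, dimension `d`, order `n`** [LiebSahi2021, §1–§2,
verbatim setting: "the unit hypercube `Q_k = [0,1]^k` … equipped with the Lebesgue measure and the usual partial
order … a real valued function `f` on `Q_k` is monotone (decreasing) if `x ≤ x'` implies `f(x) ≥ f(x')`",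
"positive as a synonym for non-negative"; Conjecture 1.1: "If `f_1,…,f_n` are positive monotone functions … then
`E_n(f_1,…,f_n) ≥ 0`"]: for all nonnegative monotone decreasing `f_0,…,f_{n−1} : Q_d → ℝ`,
`E_n(f_0,…,f_{n−1}) ≥ 0`, `E_n` taken for Lebesgue measure on `Q_d = (Fin d → [0,1])`
(`Literature.Combinatorics.Sahi2008.msahiE volume n f`, Lieb–Sahi's Def. 3.1).  THEOREMS for `d ≤ 2`
(`liebSahiContinuum_of_le_two`); OPEN for `d ≥ 3`, `n ≥ 3`.  An obligation / hypothesis — use as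
`(h : LiebSahiContinuum d n)`; equivalent for all `d` together to `SahiConjecture n`
(`sahiConjecture_iff_forall_liebSahiContinuum`).  Never import as a fact.
[cite: LiebSahi2021, Conj. 1.1 with §1 ("the continuous case of the Lebesgue measure on the unit hypercube") and §2]
[status: open] -/
@[conjecture] def LiebSahiContinuum (d n : ℕ) : Prop :=
  ∀ f : Fin n → (Fin d → I) → ℝ, (∀ i x, 0 ≤ f i x) → (∀ i, Antitone (f i)) →
    0 ≤ msahiE (volume : Measure (Fin d → I)) n f

/-! ### Increasing form, and the discretisation -/

/-- **Decreasing = increasing**: the obligation is the Sahi positivity of order `n` of Lebesgue measure on `Q_d`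
(nonnegative monotone INCREASING families), by Lieb–Sahi's change of variables `x_i ↦ 1 − x_i`, which preserves
Lebesgue measure and reverses the order. [cite: LiebSahi2021, §2 (footnote 2 and the change of variables)] -/
theorem liebSahiContinuum_iff_mSahiPositive {d n : ℕ} :
    LiebSahiContinuum d n ↔ MSahiPositive (volume : Measure (Fin d → I)) n := by
  have hmp : MeasurePreserving (fun (x : Fin d → I) (j : Fin d) => unitInterval.symm (x j)) volume volume :=
    volume_preserving_pi fun _ => unitInterval.measurePreserving_symm
  have hme : MeasurableEmbedding (fun (x : Fin d → I) (j : Fin d) => unitInterval.symm (x j)) :=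
    (MeasurableEquiv.piCongrRight fun _ : Fin d => unitInterval.symmMeasurableEquiv).measurableEmbedding
  have hanti : ∀ x y : Fin d → I, x ≤ y →
      (fun j => unitInterval.symm (y j)) ≤ fun j => unitInterval.symm (x j) :=
    fun x y hxy j => unitInterval.symm_le_symm.2 (hxy j)
  constructor
  · intro h f hf0 hmono
    rw [← msahiE_comp_measurePreserving hmp hme n f]
    exact h _ (fun i x => hf0 i _) fun i x y hxy => hmono i (hanti x y hxy)
  · intro h f hf0 hanti'
    rw [← msahiE_comp_measurePreserving hmp hme n f]
    exact h _ (fun i x => hf0 i _) fun i x y hxy => hanti' i (hanti x y hxy)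

/-- **Lebesgue measure on `Q_d` ⟺ the uniform weight on every discrete box `[M]^d`** (layer `U(d,n)` of the
width stratification): Lieb–Sahi's discretisation Lemma 2.3 / 3.8 in dimension `d` (Riemann sandwich of monotone
functions, continuity of the moment polynomial) one way, grid step functions the other.
[cite: LiebSahi2021, Lemma 3.8 (with Lemma 2.3)] -/
theorem liebSahiContinuum_iff_uniformGrid (d n : ℕ) :
    LiebSahiContinuum d n ↔
      ∀ M : ℕ, 0 < M → SahiPositive (fun _ : Fin d → Fin M => (1 : ℝ) / (M : ℝ) ^ d) n := by
  rw [liebSahiContinuum_iff_mSahiPositive, LebesgueCube.mSahiPositive_volume_iff_uniformGrid]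

/-- **Lebesgue measure on `Q_d` ⟺ every product probability weight on every grid `[K+1]^d`** (layer `P(d,n)`;
through `SahiWidth.liebSahi_grid_iff_uniform`: block maps and continuity of `E_n` in the weight). [this work] -/
theorem liebSahiContinuum_iff_prodGrid (d n : ℕ) :
    LiebSahiContinuum d n ↔
      ∀ (K : ℕ) (g : Fin d → Fin (K + 1) → ℝ), (∀ i u, 0 ≤ g i u) → (∀ i, ∑ u, g i u = 1) →
        SahiPositive (fun ω : Fin d → Fin (K + 1) => ∏ i, g i (ω i)) n := by
  rw [liebSahiContinuum_iff_uniformGrid, SahiWidth.liebSahi_grid_iff_uniform]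

/-- **Lebesgue measure on `Q_d` ⟺ every FKG probability weight on every grid `[b+1]^d`** (layer `W(d,n)`;
through `SahiWidth.fkg_grid_iff_uniform`: the parametrised Rosenblatt coupling). [this work] -/
theorem liebSahiContinuum_iff_fkgGrid (d n : ℕ) :
    LiebSahiContinuum d n ↔
      ∀ (b : ℕ) (μ : (Fin d → Fin (b + 1)) → ℝ), IsFKGMeasure μ → SahiPositive μ n := by
  rw [liebSahiContinuum_iff_uniformGrid, SahiWidth.fkg_grid_iff_uniform]

/-- **From the hypercube to every lattice of width `≤ d`**: if Lebesgue measure on `Q_d` satisfies `E_n ≥ 0`,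
then so does every FKG probability weight on every finite distributive lattice admitting a lattice embedding into
a `d`-dimensional grid (equivalently, whose poset of join-irreducibles has width `≤ d`). [this work] -/
theorem sahiPositive_of_liebSahiContinuum_of_latticeEmbedding {d n : ℕ} (h : LiebSahiContinuum d n)
    {L : Type*} [DistribLattice L] [Fintype L] [DecidableEq L] {b : ℕ} (e : L → (Fin d → Fin (b + 1)))
    (he : Function.Injective e) (hinf : ∀ x y, e (x ⊓ y) = e x ⊓ e y) (hsup : ∀ x y, e (x ⊔ y) = e x ⊔ e y)
    {μ : L → ℝ} (hμ : IsFKGMeasure μ) : SahiPositive μ n :=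
  SahiWidth.sahiPositive_of_latticeEmbedding_grid ((liebSahiContinuum_iff_prodGrid d n).1 h) e he hinf hsup hμ

/-! ### Sahi's conjectures ⟺ the continuous case on all hypercubes -/

/-- **Sahi's Conjecture 5 at order `n` ⟺ Lieb–Sahi's continuous case on every unit hypercube at order `n`.**
`SahiConjecture n` (`E_n ≥ 0` for every FKG probability weight on every finite distributive lattice) holds if and
only if `E_n ≥ 0` for positive monotone functions on `Q_d` with Lebesgue measure, for every `d`.  (`⇒`: discretise
and take the uniform boxes, which are FKG; `⇐`: Lebesgue gives the uniform boxes, hence all product grids, hence —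
Kahn's underlying independents / Birkhoff — every FKG poset.) [this work] -/
theorem sahiConjecture_iff_forall_liebSahiContinuum (n : ℕ) :
    SahiConjecture n ↔ ∀ d, LiebSahiContinuum d n := by
  rw [SahiWidth.sahiConjecture_iff_forall_uniformGrid]
  exact ⟨fun h d => (liebSahiContinuum_iff_uniformGrid d n).2 (h d),
    fun h d => (liebSahiContinuum_iff_uniformGrid d n).1 (h d)⟩

/-- **The full hierarchy**: Sahi's Conjecture 5 for every `n` ⟺ `E_n ≥ 0` for positive monotone functions on
every unit hypercube with Lebesgue measure, every `n`. [this work] -/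
theorem forall_sahiConjecture_iff_forall_liebSahiContinuum :
    (∀ n, SahiConjecture n) ↔ ∀ d n, LiebSahiContinuum d n :=
  ⟨fun h d n => (sahiConjecture_iff_forall_liebSahiContinuum n).1 (h n) d,
    fun h n => (sahiConjecture_iff_forall_liebSahiContinuum n).2 fun d => h d n⟩

/-- **Sahi's Conjecture 4 (= Lieb–Sahi's Conjecture 1.2, the generating function) ⟺ the continuous case on all
hypercubes, all orders.** [this work] -/
theorem sahiGFConjecture_iff_forall_liebSahiContinuum : SahiGFConjecture ↔ ∀ d n, LiebSahiContinuum d n := by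
  rw [sahiGFConjecture_iff_forall_sahiConjecture, forall_sahiConjecture_iff_forall_liebSahiContinuum]

/-- **Kahn's Conjecture 5 ⟺ `E_3 ≥ 0` for positive monotone functions on every unit hypercube with Lebesgue
measure** (`KahnConjecture ⟺ SahiConjecture 3`, `sahiConjecture_three_iff_kahnConjecture`). [this work] -/
theorem kahnConjecture_iff_forall_liebSahiContinuum_three : KahnConjecture ↔ ∀ d, LiebSahiContinuum d 3 := by
  rw [← sahiConjecture_three_iff_kahnConjecture, sahiConjecture_iff_forall_liebSahiContinuum]

/-! ### The hierarchy in `n`, monotonicity in the dimension, and the proved layers -/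

/-- **Hierarchy**: the continuous case at order `n` implies it at every lower order (Sahi's branching, on the
uniform boxes / FKG grid weights). [cite: LiebSahi2021, p. 3 (after eq. (1.3)); Sahi2008, Thm. 6] -/
theorem LiebSahiContinuum.anti {d m n : ℕ} (hmn : m ≤ n) (h : LiebSahiContinuum d n) : LiebSahiContinuum d m := by
  rw [liebSahiContinuum_iff_fkgGrid] at h ⊢
  exact fun b μ hμ => (h b μ hμ).anti hμ.nonneg hμ.sum_eq_one hmn

/-- **Monotonicity in the dimension**: the continuous case on `Q_{d'}` implies it on `Q_d` for `d ≤ d'` (a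
`d`-dimensional box is a sublattice of a `d'`-dimensional one by zero padding of the extra coordinates).
[this work] -/
theorem LiebSahiContinuum.of_le_dim {d d' n : ℕ} (hdd' : d ≤ d') (h : LiebSahiContinuum d' n) :
    LiebSahiContinuum d n := by
  rw [liebSahiContinuum_iff_fkgGrid]
  intro b μ hμ
  classical
  refine sahiPositive_of_liebSahiContinuum_of_latticeEmbedding h
    (fun (ω : Fin d → Fin (b + 1)) (j : Fin d') => if hj : (j : ℕ) < d then ω ⟨j, hj⟩ else 0)
    (fun ω ω' hωω' => ?_) (fun ω ω' => ?_) (fun ω ω' => ?_) hμ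
  · funext i
    have hi := congrFun hωω' (Fin.castLE hdd' i)
    simp only [Fin.val_castLE, Fin.is_lt, dite_true, Fin.eta] at hi
    exact hi
  · funext j
    simp only [Pi.inf_apply]
    split_ifs with hj
    · rfl
    · exact (inf_idem (0 : Fin (b + 1))).symm
  · funext j
    simp only [Pi.sup_apply]
    split_ifs with hj
    · rfl
    · exact (sup_idem (0 : Fin (b + 1))).symm

/-- **Layer `d = 1` is a theorem**: `E_n ≥ 0` for positive monotone functions on `[0,1]` with Lebesgue measure,
every `n` (chains — Blinovsky's lemma; Lieb–Sahi's remark after Lemma 3.2).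
[cite: LiebSahi2021, Lemma 3.2 (remark following it)] -/
theorem liebSahiContinuum_one (n : ℕ) : LiebSahiContinuum 1 n :=
  (liebSahiContinuum_iff_prodGrid 1 n).2 (SahiWidth.liebSahi_grid_one n)

/-- **Layer `d = 2` is a theorem**: `E_n ≥ 0` for positive monotone functions on `[0,1]²` with Lebesgue measure,
every `n` — Lieb–Sahi's Theorem 3.7 (here through the product grids `ProductChains.sahiPositive_prodWeight`; the
tree also has it as printed on `I × I`, `liebSahi_thm37`). [cite: LiebSahi2021, Thm. 3.7] -/
theorem liebSahiContinuum_two (n : ℕ) : LiebSahiContinuum 2 n :=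
  (liebSahiContinuum_iff_prodGrid 2 n).2 (SahiWidth.liebSahi_grid_two n)

/-- Layer `d = 0` (a one-point space) holds trivially. [this work] -/
theorem liebSahiContinuum_zero (n : ℕ) : LiebSahiContinuum 0 n :=
  (liebSahiContinuum_one n).of_le_dim (Nat.zero_le 1)

/-- **The layers `d ≤ 2` of the continuous case are theorems, every order `n`.** [cite: LiebSahi2021, Thm. 3.7] -/
theorem liebSahiContinuum_of_le_two {d : ℕ} (hd : d ≤ 2) (n : ℕ) : LiebSahiContinuum d n :=
  (liebSahiContinuum_two n).of_le_dim hd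

/-- The orders `n ≤ 2` hold in every dimension (`E_1 ≥ 0`, and `n = 2` is the FKG inequality for Lebesgue measure
on `Q_d`, via the FKG grid weights). [cite: LiebSahi2021, §1 (the FKG inequality holds for the Lebesgue measure on `Q_k`)] -/
theorem liebSahiContinuum_of_order_le_two (d : ℕ) {n : ℕ} (hn : n ≤ 2) : LiebSahiContinuum d n :=
  (sahiConjecture_iff_forall_liebSahiContinuum n).1 (sahiConjecture_of_le_two hn) d

/-- **Where the open problem sits**: Sahi's Conjecture 5 for all `n` is equivalent to the continuous case on the
unit hypercubes `Q_d` for `d ≥ 3` and orders `n ≥ 3` only (lower layers and orders being theorems). [this work] -/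
theorem forall_sahiConjecture_iff_liebSahiContinuum_three_le :
    (∀ n, SahiConjecture n) ↔ ∀ d n, 3 ≤ d → 3 ≤ n → LiebSahiContinuum d n := by
  rw [forall_sahiConjecture_iff_forall_liebSahiContinuum]
  refine ⟨fun h d n _ _ => h d n, fun h d n => ?_⟩
  by_cases hd : 3 ≤ d
  · by_cases hn : 3 ≤ n
    · exact h d n hd hn
    · exact liebSahiContinuum_of_order_le_two d (by omega)
  · exact liebSahiContinuum_of_le_two (by omega) n

/-! ### The literal setting `Q_d ⊆ ℝ^d` -/

/-- The unit hypercube `Q_d = [0,1]^d` as a subset of `ℝ^d`. [cite: LiebSahi2021, §2 (eq. for `Q_k`)] -/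
def unitCube (d : ℕ) : Set (Fin d → ℝ) := Set.pi Set.univ fun _ => Set.Icc (0 : ℝ) 1

/-- The inclusion `(Fin d → [0,1]) → ℝ^d` is a measurable embedding (plumbing: its image of a measurable set is
the trace on `Q_d` of the preimage under the coordinatewise retraction `projIcc`). [folklore] -/
private theorem measurableEmbedding_cubeIncl (d : ℕ) :
    MeasurableEmbedding (fun (x : Fin d → I) (j : Fin d) => (x j : ℝ)) where
  injective := fun x y h => funext fun j => Subtype.ext (congrFun h j)
  measurable := measurable_pi_lambda _ fun j => measurable_subtype_coe.comp (measurable_pi_apply j)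
  measurableSet_image' := by
    intro s hs
    have hr : Measurable fun (y : Fin d → ℝ) (j : Fin d) => Set.projIcc (0 : ℝ) 1 zero_le_one (y j) :=
      measurable_pi_lambda _ fun j => continuous_projIcc.measurable.comp (measurable_pi_apply j)
    have himg : (fun (x : Fin d → I) (j : Fin d) => (x j : ℝ)) '' s =
        (fun (y : Fin d → ℝ) (j : Fin d) => Set.projIcc (0 : ℝ) 1 zero_le_one (y j)) ⁻¹' s ∩ unitCube d := by
      ext y
      constructor
      · rintro ⟨x, hx, rfl⟩
        refine ⟨?_, fun j _ => (x j).2⟩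
        have hx' : (fun j => Set.projIcc (0 : ℝ) 1 zero_le_one ((x j : ℝ))) = x :=
          funext fun j => Set.projIcc_val zero_le_one (x j)
        rw [Set.mem_preimage, hx']
        exact hx
      · rintro ⟨hy, hyQ⟩
        refine ⟨fun j => Set.projIcc 0 1 zero_le_one (y j), hy, funext fun j => ?_⟩
        show ((Set.projIcc (0 : ℝ) 1 zero_le_one (y j) : I) : ℝ) = y j
        rw [Set.projIcc_of_mem zero_le_one (hyQ j (Set.mem_univ j))]
    rw [himg]
    exact (hr hs).inter (MeasurableSet.univ_pi fun _ => measurableSet_Icc)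

/-- The inclusion pushes Lebesgue measure of `(Fin d → [0,1])` to Lebesgue measure of `ℝ^d` restricted to `Q_d`
(plumbing). [folklore] -/
private theorem measurePreserving_cubeIncl (d : ℕ) :
    MeasurePreserving (fun (x : Fin d → I) (j : Fin d) => (x j : ℝ)) volume
      ((volume : Measure (Fin d → ℝ)).restrict (unitCube d)) := by
  have h := measurePreserving_pi (fun _ : Fin d => (volume : Measure I))
    (fun _ : Fin d => (volume : Measure ℝ).restrict (Set.Icc (0 : ℝ) 1))
    fun _ => unitInterval.measurePreserving_coe
  rw [← Measure.restrict_pi_pi] at h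
  exact h

/-- **The obligation in Lieb–Sahi's literal setting** `Q_d = [0,1]^d ⊆ ℝ^d` with (restricted) Lebesgue measure:
`LiebSahiContinuum d n` holds iff `E_n(f_0,…,f_{n−1}) ≥ 0` for all `f_i : ℝ^d → ℝ` nonnegative and monotone
decreasing on `Q_d`, `E_n` taken for `λ|_{Q_d}`.  (`⇒` along the inclusion; `⇐` along the coordinatewise
retraction `projIcc`, which is monotone.) [cite: LiebSahi2021, §2 (the setting `Q_k ⊂ ℝ^k`)] -/
theorem liebSahiContinuum_iff_real (d n : ℕ) :
    LiebSahiContinuum d n ↔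
      ∀ f : Fin n → (Fin d → ℝ) → ℝ, (∀ i, ∀ y ∈ unitCube d, 0 ≤ f i y) →
        (∀ i, AntitoneOn (f i) (unitCube d)) →
          0 ≤ msahiE ((volume : Measure (Fin d → ℝ)).restrict (unitCube d)) n f := by
  have hmem : ∀ x : Fin d → I, (fun j => (x j : ℝ)) ∈ unitCube d := fun x j _ => (x j).2
  constructor
  · intro h f hf0 hanti
    rw [← msahiE_comp_measurePreserving (measurePreserving_cubeIncl d) (measurableEmbedding_cubeIncl d) n f]
    refine h _ (fun i x => hf0 i _ (hmem x)) fun i x y hxy => ?_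
    exact hanti i (hmem x) (hmem y) fun j => Subtype.coe_le_coe.2 (hxy j)
  · intro h f hf0 hanti
    set r : (Fin d → ℝ) → (Fin d → I) := fun y j => Set.projIcc (0 : ℝ) 1 zero_le_one (y j) with hr
    have hrm : Monotone r := fun y y' hyy' j => Set.monotone_projIcc zero_le_one (hyy' j)
    have key := msahiE_comp_measurePreserving (measurePreserving_cubeIncl d) (measurableEmbedding_cubeIncl d) n
      (fun i => f i ∘ r)
    have hback : (fun i => (f i ∘ r) ∘ fun (x : Fin d → I) (j : Fin d) => (x j : ℝ)) = f := by
      funext i x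
      simp only [Function.comp_apply, hr, Set.projIcc_val]
    rw [hback] at key
    rw [key]
    exact h _ (fun i y _ => hf0 i _) fun i y _ y' _ hyy' => hanti i (hrm hyy')

/-! ### The first open layer `d = 3` and the products of three chains -/

/-- **`Q_3` ⟺ every FKG weight on every product of three finite chains** (all orders): the continuous case on
the unit cube `[0,1]³` holds for every `n` iff every FKG probability weight on every `α × β × γ` (finite linear
orders) is Sahi-positive of every order — the hypothesis/conclusion of P1's Theorem F
(`SahiThreeDim.liebSahi_prod₃_iff_fkg_prod₃`), now identified with Lieb–Sahi's own cube. [this work] -/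
theorem forall_liebSahiContinuum_three_iff_fkg_prod₃ :
    (∀ n, LiebSahiContinuum 3 n) ↔
      ∀ (α β γ : Type) [LinearOrder α] [Fintype α] [LinearOrder β] [Fintype β] [LinearOrder γ] [Fintype γ]
        (μ : (α × β) × γ → ℝ), IsFKGMeasure μ → ∀ n, SahiPositive μ n := by
  classical
  constructor
  · intro h α β γ _ _ _ _ _ _ μ hμ n
    -- embed `α × β × γ` into the box `[b+1]^3`, `b + 1 = |α| + |β| + |γ| + 1`
    set b : ℕ := Fintype.card α + Fintype.card β + Fintype.card γ with hb
    have hα : Fintype.card α ≤ b + 1 := by omega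
    have hβ : Fintype.card β ≤ b + 1 := by omega
    have hγ : Fintype.card γ ≤ b + 1 := by omega
    set ια : α → Fin (b + 1) := fun a => Fin.castLE hα ((monoEquivOfFin α rfl).symm a) with hια
    set ιβ : β → Fin (b + 1) := fun a => Fin.castLE hβ ((monoEquivOfFin β rfl).symm a) with hιβ
    set ιγ : γ → Fin (b + 1) := fun a => Fin.castLE hγ ((monoEquivOfFin γ rfl).symm a) with hιγ
    have mα : Monotone ια := fun x y hxy =>
      (Fin.strictMono_castLE hα).monotone ((monoEquivOfFin α rfl).symm.monotone hxy)
    have mβ : Monotone ιβ := fun x y hxy =>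
      (Fin.strictMono_castLE hβ).monotone ((monoEquivOfFin β rfl).symm.monotone hxy)
    have mγ : Monotone ιγ := fun x y hxy =>
      (Fin.strictMono_castLE hγ).monotone ((monoEquivOfFin γ rfl).symm.monotone hxy)
    have iα : Function.Injective ια := (Fin.castLE_injective hα).comp (monoEquivOfFin α rfl).symm.injective
    have iβ : Function.Injective ιβ := (Fin.castLE_injective hβ).comp (monoEquivOfFin β rfl).symm.injective
    have iγ : Function.Injective ιγ := (Fin.castLE_injective hγ).comp (monoEquivOfFin γ rfl).symm.injective
    refine sahiPositive_of_liebSahiContinuum_of_latticeEmbedding (h n)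
      (fun p : (α × β) × γ => ![ια p.1.1, ιβ p.1.2, ιγ p.2]) (fun p q hpq => ?_) (fun p q => ?_)
      (fun p q => ?_) hμ
    · have h0 := congrFun hpq 0
      have h1 := congrFun hpq 1
      have h2 := congrFun hpq 2
      simp only [Matrix.cons_val_zero, Matrix.cons_val_one, Matrix.cons_val] at h0 h1 h2
      exact Prod.ext (Prod.ext (iα h0) (iβ h1)) (iγ h2)
    · funext j
      fin_cases j
      · simpa using mα.map_inf p.1.1 q.1.1
      · simpa using mβ.map_inf p.1.2 q.1.2
      · simpa using mγ.map_inf p.2 q.2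
    · funext j
      fin_cases j
      · simpa using mα.map_sup p.1.1 q.1.1
      · simpa using mβ.map_sup p.1.2 q.1.2
      · simpa using mγ.map_sup p.2 q.2
  · intro H n
    rw [liebSahiContinuum_iff_fkgGrid]
    intro b μ hμ
    have H3 := SahiThreeDim.liebSahi_prod₃_iff_fkg_prod₃.2 H
    refine SahiThreeDim.sahiPositive_of_latticeEmbedding_prod₃ H3
      (fun ω : Fin 3 → Fin (b + 1) => ((ω 0, ω 1), ω 2)) (fun ω ω' h => ?_) (fun ω ω' => rfl)
      (fun ω ω' => rfl) hμ n
    funext j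
    fin_cases j
    · exact congrArg (fun p : (Fin (b + 1) × Fin (b + 1)) × Fin (b + 1) => p.1.1) h
    · exact congrArg (fun p : (Fin (b + 1) × Fin (b + 1)) × Fin (b + 1) => p.1.2) h
    · exact congrArg (fun p : (Fin (b + 1) × Fin (b + 1)) × Fin (b + 1) => p.2) h

end Summit.CriticalPhenomena.PercolationContinuityZ3.Theorems
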